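import Summits.BirchSwinnertonDyer.BirchSwinnertonDyer.Theorems.ClassRecordThreeKolyvaginShaOrderDivisibleEnd
import Summits.BirchSwinnertonDyer.BirchSwinnertonDyer.Theorems.Rank1ResidualJetRingClassFields
import Summits.BirchSwinnertonDyer.Rank1Residual.JET.CarrierEndFormsGross1991
import HarnessLib

/-!
# Crux 19715 `ErratumRoadFive.EulerHalfNotRamNoInertSetAtFive` — line `modular_rethread`:
# THE RE-THREAD OF ITEM 27981 CONJUNCT 2 ([GZ86 III (3.1)] ∕ Gross 1991 §6, `Gross1991_heegnerPoint_sub_ratTorsion_mem_E0`)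
# THROUGH A PER-CURVE SUPPLY — the KolyvaginHloc-shape consumer sites (3)(4) (McCallum Cor. 5.6 upper) KERNEL-DONE here
# (ideator `bsd-idea-9` g11, D-0154 §B lens = complete; Lines workfile, no proposal, no registry verb)

WHY. Along the v15 ∕ v16 zero-leaf closers of crux 19715 (p650825 road A, p650861 road B) the exceptional-zero core S1b
(`EulerHalfBirthAssembly.res_pOnlyMultCarrierAtFive_of_items_of_twoPrintFacts` →
`JetchevMaxHLAtP.res_pOnlyMultCarrierAtFive_of_swapPrintFacts_of_lowerX11a`) feeds item 27981's SECOND conjunct (the printed input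
[GZ86 III (3.1)], primary text not held) into FOUR consumer sites in TWO schema shapes:

* JET shape (`JET.forall_hGZ_of_Gross1991`'s conclusion at a frame `(W, K, p, Dt, β, ι)`):
  (1) `X11b.AtP.Koly.selmerSupplyAtP_of_poitouTate_Gross1991` (`Theorems/ErratumRoadFiveJetchevAtPSupply.lean` l.220) and
  (2) `JET.Swap.levelRaising_of_literature` (`Theorems/Rank1ResidualJetSwapLevelRaisingLiterature.lean` l.145),
  both under `AtP.Koly.jetchevMaxHLAtP_of_swapLiterature` (SwapEnd l.255 ∕ l.273);
* KolyvaginHloc shape (`X11b.KolyvaginHloc.hGZ_of_gross1991E0`'s conclusion on a divisor-closed data system `d : (m ∣ n) → …`):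
  (3) `KolyvaginOrder.card_sha_primary_le_at_of_divT_frame_of_gross1991E0_of_prop37_of_localDuality`
  (`Theorems/ClassRecordThreeKolyvaginShaOrderDivisibleEnd.lean` ll.146–148) and
  (4) `KolyvaginDischarged.pow_smul_sha_primary_eq_zero_at_of_gross1991E0_of_prop37` (`X11b/KolyvaginShaAtPrimeOfGross1991.lean` l.155),
  both under McCallum Cor. 5.6 upper `McCallum1991_…_of_casselsTate_of_prop37_of_E0` (ll.185–300; SwapStub l.97).

Width seat -w5 g0's «MODULAR AUX-NORM» (F-A…F-E, 2026-08-28T17:00Z; the ideator's lever `aux-norm-receptacle` ported to the `X₀(N)` family at the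
K-split self-carrier `q = p`) PRODUCES the JET shape at every S1b frame (`p` the only multiplicative prime, split, `p ∣ c_p`, `ρ̄` onto, `p ≥ 5`)
WITHOUT [GZ86 III (3.1)]. For conjunct 2 to leave 19715's cone, ALL FOUR sites must take a PER-CURVE supply instead of the global fact.

WHAT (sorry-free theorems; every input a named binder; no definition, no instance, no named fact).
* §1 `hGZHloc_of_hGZJet` — at a frame, the JET shape IMPLIES the KolyvaginHloc shape (the witness `n'` is kept; `IsCoprime p n' ⇒ IsCoprime p^M n'`;
  a divisor `m ∣ n` of a squarefree `n` is squarefree with Kolyvagin prime factors, Gross's `IsKolyvaginPrime ∧ FrobEqFrobInfty (p^M)` with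
  `M ≥ 1` giving Zhang's `IsKolyvaginPrime` by `McCallum1991.le_kolyvaginIndex_of_frobEqFrobInfty`; `dm := d m hm`, `dm' := d (m ∕ ℓ) _`).
* §2 `hGZHlocBinder_of_hGZJetW` — the `hGZ` BINDER of the x11b leaf forms (`KolyvaginAnnihilator.pow_smul_sha_primary_eq_zero_at_of_leafInputs_of_poitouTate`,
  `KolyvaginAssembly.hpoints_at_of_perLevelChoice_of_divT_frame`) VERBATIM (with `N := W.conductorNorm ℤ`), from the PER-CURVE JET supply
  `hJW : ∀ K (imag. quadratic, d_K ∉ {−3, −4}, Heegner for N_E) Dt β ι, ‹JET shape›` at fixed `(W, p)`.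
* §3 `mcCallumUpperAt_of_casselsTate_of_prop37_of_hGZJetW` — **McCallum 1991 Cor. 5.6 upper half under global divisibility AT `(W, p)`**
  (the body of the named fact `McCallum1991_padicValNat_card_sha_primary_add_le_of_globalDivisibility` with `W` and `p` fixed, VERBATIM) from
  {`casselsTate_levelInputs` (every number field) = item `ShimuraCasselsTateLevelInputs`, Gross Prop. 3.7 (2) at `(W, p)` (every `K`), the per-curve
  JET supply `hJW`} — tam3-p1 g9's proof of `…_of_casselsTate_of_prop37_of_E0` (p. 311) with its two `KolyvaginHloc.hGZ_of_gross1991E0 hE0 …` lambdas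
  (sites (3) and (4)) replaced by §2. THIS IS SITES (3)(4) RE-THREADED, kernel-checked; a prover copies it to `Theorems/` unchanged.
* §4 `hGZJetW_of_Gross1991` — sanity: the old global fact gives the per-curve supply at every `(W, p)` with `p ≠ 2`, `ρ̄_{E,p}` onto
  (`JET.forall_hGZ_of_Gross1991` + `numberField_ringClassField`), so §3 SPECIALISES BACK to the tree's theorem at `(W, p)`: no strength is lost.

PORT MAP for sites (1)(2) and the layers above (prover work, NOT done here; near-verbatim copies with ONE binder edit each,
`(hF1 : Gross1991_heegnerPoint_sub_ratTorsion_mem_E0)` ↦ `(hJW : ‹§2's hJW type›)` at the layer's `(W, p)`): see `Lines/modular_rethread.md` §PORT.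

HONEST FRAMING: Lines workfile of the ideator (W-71 ∕ W-79: no proposal, no `skeleton check`, no route verb). CONDITIONAL on the displayed binders;
nothing is discharged about [GZ86 III (3.1)] itself; item 27981 is NOT edited by this file (planner's call); crux 19715 stays ledger-open; no census
number moves; BSD is proved for no curve; no summit statement is proved by this seat.
References (locators only): [cite: McCallumLMS1991, §5 Lemma 5.1, Thm. 5.4, Cor. 5.6 (pp. 310–311)] [cite: GrossLMS1991, §3 (3.1)–(3.3), Prop. 3.7 (2),
§6 proof of Prop. 6.2 (1) (p. 245)] [cite: GrossZagier1986Heegner, III (3.1) (p. 256)] [cite: WZhang2014, Notations (xii)] [cite: Cox2013, §9.A].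
-/

set_option autoImplicit false
set_option linter.dupNamespace false

noncomputable section

open scoped Classical Pointwise

namespace Summit.BirchSwinnertonDyer.BirchSwinnertonDyer.Cruxes.EulerHalfNotRamNoInertSetAtFive.ModularRethread

open WeierstrassCurve NumberField IsDedekindDomain Field Function
open Literature.NumberTheory.EllipticCurves Literature.NumberTheory.EllipticCurves.KolyvaginDescent
open Literature.NumberTheory.EllipticCurves.KolyvaginCocycle
open Literature.NumberTheory.EllipticCurves.RingClassField
open Literature.NumberTheory.EllipticCurves.ModularForms
open Literature.NumberTheory.GaloisRepresentations
open Literature.NumberTheory.GaloisCohomology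
open Literature.NumberTheory.EllipticCurves.GrossLMS1991 (prop37_2_reductionCongruence)
open Summit.BirchSwinnertonDyer.Rank1Residual Summit.BirchSwinnertonDyer.Rank1Residual.X11b
open Summit.BirchSwinnertonDyer.Rank1Residual.X11b.KolyvaginAssembly
open Summit.BirchSwinnertonDyer.Rank1Residual.X11b.KolyvaginCT

-- Cup products need `LocallyCompactSpace Γ_K`; as in the tree's Cassels–Tate files (§3 only).
attribute [local instance] absoluteGaloisGroup_compactSpace

-- `CharZero` of the completions (the Cassels–Tate local terms), as in the tree's files (§3 only).
attribute [local instance] charZero_placeCompletion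

/-! ### §1 JET shape ⇒ KolyvaginHloc shape, at one frame -/

/-- **At a frame `(W, K, p, Dt, β, ι)`, the JET-shape receptacle schema implies the KolyvaginHloc-shape one.** The JET shape (conclusion of
`JET.forall_hGZ_of_Gross1991` ∕ of -w5 g0's `ModularAuxNorm.hGZ_of_onlyMult_of_galTrivial_of_kills`) quantifies over squarefree `m` with
ZHANG–Kolyvagin prime factors and one datum `dm` (+ one `dm'` at `m ∕ ℓ`); the Hloc shape (conclusion of `KolyvaginHloc.hGZ_of_gross1991E0`, the
`hGZ` binder of the x11b leaf forms) quantifies over the divisors `m ∣ n` of a squarefree `n` with GROSS–Kolyvagin prime factors congruent at level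
`p^M`, `M ≥ 1`, and a data system `d`. Same witness `n'`. [cite: GrossLMS1991, §3 (3.1)–(3.3)] [cite: WZhang2014, Notations (xii)]
[cite: McCallumLMS1991, §4 (pp. 299–300)] -/
theorem hGZHloc_of_hGZJet (W : WeierstrassCurve ℚ) [W.IsElliptic] [W.IsGloballyMinimal] [NeZero (W.conductorNorm ℤ)]
    (K : Type) [Field K] [NumberField K] {p : ℕ} (hp : p.Prime)
    (Dt : ModularParametrizationData W (W.conductorNorm ℤ)) (β : ℤ) (ι : K →+* ℂ)
    (hJ : ∃ n' : ℤ, IsCoprime (p : ℤ) n' ∧ ∀ (m : ℕ), Squarefree m →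
        (∀ q ∈ m.primeFactors, Zhang2014.IsKolyvaginPrime (W.conductorNorm ℤ) W K p q) →
        ∀ (dm : KolyvaginHeegnerData Dt β ι m)
        (γ : ringClassField K ι m ≃ₐ[ℚ] ringClassField K ι m), γ ∈ ringClassGal ι m →
        ∀ v : HeightOneSpectrum (𝓞 K), ¬ (W.baseChange K).HasGoodReductionAt v →
          n' • pointsMap (W.baseChange K) (v.adicCompletion K)
              (dm.toGeomPoints (pointGalHom W (ringClassField K ι m) γ dm.y)) ∈
            E0Receptacle (W.baseChange K) v ∧
          ∀ (ℓ : ℕ), ℓ ∈ m.primeFactors → ∀ (dm' : KolyvaginHeegnerData Dt β ι (m / ℓ))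
            (hle : ringClassField K ι (m / ℓ) ≤ ringClassField K ι m),
            n' • pointsMap (W.baseChange K) (v.adicCompletion K)
                (dm.toGeomPoints (pointGalHom W (ringClassField K ι m) γ
                  (WeierstrassCurve.Affine.Point.map (W' := W)
                    ((RingClassField.inclusion ι hle).restrictScalars ℚ) dm'.y))) ∈
              E0Receptacle (W.baseChange K) v)
    {M : ℕ} (hM : 1 ≤ M) {n : ℕ} (hn : Squarefree n)
    (hKol : ∀ q ∈ n.primeFactors, IsKolyvaginPrime (W.conductorNorm ℤ) W K p q ∧ FrobEqFrobInfty W K (p ^ M) q)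
    (d : (m : ℕ) → m ∣ n → KolyvaginHeegnerData Dt β ι m) :
    ∃ n' : ℤ, IsCoprime ((p ^ M : ℕ) : ℤ) n' ∧
      ∀ (m : ℕ) (hm : m ∣ n) (γ : ringClassField K ι m ≃ₐ[ℚ] ringClassField K ι m),
        γ ∈ ringClassGal ι m → ∀ v : HeightOneSpectrum (𝓞 K),
          ¬ (W.baseChange K).HasGoodReductionAt v →
          n' • pointsMap (W.baseChange K) (v.adicCompletion K)
              ((d m hm).toGeomPoints (pointGalHom W (ringClassField K ι m) γ (d m hm).y)) ∈
            E0Receptacle (W.baseChange K) v ∧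
          ∀ (ℓ : ℕ) (hℓ : ℓ ∈ m.primeFactors)
            (hle : ringClassField K ι (m / ℓ) ≤ ringClassField K ι m),
            n' • pointsMap (W.baseChange K) (v.adicCompletion K)
                ((d m hm).toGeomPoints (pointGalHom W (ringClassField K ι m) γ
                  (WeierstrassCurve.Affine.Point.map (W' := W)
                    ((RingClassField.inclusion ι hle).restrictScalars ℚ)
                    (d (m / ℓ)
                      ((Nat.div_dvd_of_dvd (Nat.dvd_of_mem_primeFactors hℓ)).trans hm)).y))) ∈
              E0Receptacle (W.baseChange K) v := by
  obtain ⟨n', hcop, hJ'⟩ := hJ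
  refine ⟨n', ?_, fun m hm γ hγ v hv ↦ ?_⟩
  · -- `IsCoprime p n' ⇒ IsCoprime p^M n'`
    have h : IsCoprime ((p : ℤ) ^ M) n' := hcop.pow_left
    exact_mod_cast h
  · -- a divisor of the squarefree admissible `n` is squarefree and Zhang-admissible (`M ≥ 1`)
    have hmsq : Squarefree m := hn.squarefree_of_dvd hm
    have hKolm : ∀ q ∈ m.primeFactors, Zhang2014.IsKolyvaginPrime (W.conductorNorm ℤ) W K p q := by
      intro q hq
      obtain ⟨⟨hqP, hqN, hqD, hqp, hprime, -⟩, hfrob⟩ := hKol q (Nat.primeFactors_mono hm hn.ne_zero hq)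
      exact ⟨hqP, hqN, hqD, hqp, hprime,
        lt_of_lt_of_le (by omega) (McCallum1991.le_kolyvaginIndex_of_frobEqFrobInfty W K hp hM hqP hqp hqN hfrob)⟩
    obtain ⟨h1, h2⟩ := hJ' m hmsq hKolm (d m hm) γ hγ v hv
    exact ⟨h1, fun ℓ hℓ hle ↦ h2 ℓ hℓ (d (m / ℓ) _) hle⟩

/-! ### §2 The `hGZ` binder of the x11b leaf forms from the PER-CURVE JET supply -/

set_option linter.overlappingInstances false in
/-- **The `hGZ` BINDER of the x11b leaf forms at `(W, p)` (`N := W.conductorNorm ℤ`; VERBATIM the binder type of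
`KolyvaginAnnihilator.pow_smul_sha_primary_eq_zero_at_of_leafInputs_of_poitouTate` ∕ `KolyvaginAssembly.hpoints_at_of_perLevelChoice_of_divT_frame`),
from the PER-CURVE JET supply `hJW`** (every imaginary quadratic `K` with `d_K ∉ {−3, −4}` satisfying the Heegner hypothesis for `N_E`, every
frame `(Dt, β, ι)`). On S1b rows `hJW` is -w5 g0's `ModularAuxNorm.hGZ_of_onlyMult_of_galTrivial_of_kills` (+ its (T), (C) discharge at the odd
prime `p ∣ c_p`, `CarrierLocalE0OddPrime`, p648969); in general it is the old fact (§4). [cite: GrossLMS1991, §6 proof of Prop. 6.2 (1) (p. 245)] -/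
theorem hGZHlocBinder_of_hGZJetW (W : WeierstrassCurve ℚ) [W.IsElliptic] [W.IsGloballyMinimal] [NeZero (W.conductorNorm ℤ)]
    (K : Type) [Field K] [NumberField K] (hD3 : NumberField.discr K ≠ -3) (hD4 : NumberField.discr K ≠ -4)
    {p : ℕ} (hp : p.Prime)
    (hJW : IsImaginaryQuadratic K → NumberField.discr K ≠ -3 → NumberField.discr K ≠ -4 →
      SatisfiesHeegnerHypothesis (W.conductorNorm ℤ) K →
      ∀ (Dt : ModularParametrizationData W (W.conductorNorm ℤ)) (β : ℤ) (ι : K →+* ℂ),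
      ∃ n' : ℤ, IsCoprime (p : ℤ) n' ∧ ∀ (m : ℕ), Squarefree m →
        (∀ q ∈ m.primeFactors, Zhang2014.IsKolyvaginPrime (W.conductorNorm ℤ) W K p q) →
        ∀ (dm : KolyvaginHeegnerData Dt β ι m)
        (γ : ringClassField K ι m ≃ₐ[ℚ] ringClassField K ι m), γ ∈ ringClassGal ι m →
        ∀ v : HeightOneSpectrum (𝓞 K), ¬ (W.baseChange K).HasGoodReductionAt v →
          n' • pointsMap (W.baseChange K) (v.adicCompletion K)
              (dm.toGeomPoints (pointGalHom W (ringClassField K ι m) γ dm.y)) ∈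
            E0Receptacle (W.baseChange K) v ∧
          ∀ (ℓ : ℕ), ℓ ∈ m.primeFactors → ∀ (dm' : KolyvaginHeegnerData Dt β ι (m / ℓ))
            (hle : ringClassField K ι (m / ℓ) ≤ ringClassField K ι m),
            n' • pointsMap (W.baseChange K) (v.adicCompletion K)
                (dm.toGeomPoints (pointGalHom W (ringClassField K ι m) γ
                  (WeierstrassCurve.Affine.Point.map (W' := W)
                    ((RingClassField.inclusion ι hle).restrictScalars ℚ) dm'.y))) ∈
              E0Receptacle (W.baseChange K) v) :
    ∀ [W.IsElliptic] (_hK : IsImaginaryQuadratic K) (_hH : SatisfiesHeegnerHypothesis (W.conductorNorm ℤ) K)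
      (Dt : ModularParametrizationData W (W.conductorNorm ℤ)) (β : ℤ) (ι : K →+* ℂ) {M : ℕ} (_hM : 1 ≤ M) {n : ℕ}
      (_hn : Squarefree n)
      (_hKol : ∀ q ∈ n.primeFactors, IsKolyvaginPrime (W.conductorNorm ℤ) W K p q ∧ FrobEqFrobInfty W K (p ^ M) q)
      (d : (m : ℕ) → m ∣ n → KolyvaginHeegnerData Dt β ι m),
      ∃ n' : ℤ, IsCoprime ((p ^ M : ℕ) : ℤ) n' ∧
        ∀ (m : ℕ) (hm : m ∣ n) (γ : ringClassField K ι m ≃ₐ[ℚ] ringClassField K ι m),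
          γ ∈ ringClassGal ι m → ∀ v : HeightOneSpectrum (𝓞 K),
            ¬ (W.baseChange K).HasGoodReductionAt v →
            n' • pointsMap (W.baseChange K) (v.adicCompletion K)
                ((d m hm).toGeomPoints (pointGalHom W (ringClassField K ι m) γ (d m hm).y)) ∈
              E0Receptacle (W.baseChange K) v ∧
            ∀ (ℓ : ℕ) (hℓ : ℓ ∈ m.primeFactors)
              (hle : ringClassField K ι (m / ℓ) ≤ ringClassField K ι m),
              n' • pointsMap (W.baseChange K) (v.adicCompletion K)
                  ((d m hm).toGeomPoints (pointGalHom W (ringClassField K ι m) γ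
                    (WeierstrassCurve.Affine.Point.map (W' := W)
                      ((RingClassField.inclusion ι hle).restrictScalars ℚ)
                      (d (m / ℓ)
                        ((Nat.div_dvd_of_dvd (Nat.dvd_of_mem_primeFactors hℓ)).trans hm)).y))) ∈
                E0Receptacle (W.baseChange K) v :=
  fun hK hH Dt β ι _ hM _ hn hKol d ↦
    hGZHloc_of_hGZJet W K hp Dt β ι (hJW hK hD3 hD4 hH Dt β ι) hM hn hKol d

/-! ### §3 McCallum Cor. 5.6 upper half AT `(W, p)` from the per-curve JET supply — sites (3)(4) re-threaded -/

/-- **McCallum 1991 Cor. 5.6, upper half under global divisibility, AT `(W, p)`** — the body of the named fact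
`McCallum1991_padicValNat_card_sha_primary_add_le_of_globalDivisibility` with `W`, `p` FIXED, VERBATIM — from {`casselsTate_levelInputs` (every
number field), Gross 1991 Prop. 3.7 (2) at `(W, p)` (every `K`; from the image-free `GrossLMS1991.prop37_2_frobeniusCongruence` = item 27981
conjunct 1 by `prop37_2_reductionCongruence_of_frobeniusCongruence`), and the PER-CURVE JET supply `hJW` (§2)} — i.e. WITHOUT the global fact
[GZ86 III (3.1)]. PROOF = tam3-p1 g9's `…_of_casselsTate_of_prop37_of_E0` (p. 311 dictionary in that file) with the two consumer sites of the
fact (site (4), `M₀ = 0`: `KolyvaginAnnihilator.pow_smul_sha_primary_eq_zero_at_of_leafInputs_of_poitouTate`; site (3), `M₀ ≥ 1`: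
`KolyvaginAssembly.hpoints_at_of_perLevelChoice_of_divT_frame` inside `KolyvaginOrder.card_sha_primary_le_at_of_pointsMDiv_of_reciprocityFinset_of_localDuality`)
fed by `hGZHlocBinder_of_hGZJetW`. CONDITIONAL on the displayed inputs; nothing booked.
[cite: McCallumLMS1991, §1 Theorem, §4 Cor. 4.5, §5 Lemma 5.1, Thm. 5.4, Cor. 5.6 (p. 310)] [cite: Jetchev2008, p. 812 (1), Cor. 1.5]
[cite: GrossLMS1991, §3 Prop. 3.7 (2), §4 (4.1), §6 Prop. 6.2 (1)] [cite: MilneADT2006, Ch. I §6, Prop. 6.9, Thm. 6.13 (a)] -/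
theorem mcCallumUpperAt_of_casselsTate_of_prop37_of_hGZJetW
    (W : WeierstrassCurve ℚ) [W.IsElliptic] [W.IsGloballyMinimal] [NeZero (W.conductorNorm ℤ)]
    (p : ℕ) [Fact p.Prime] (hp2 : p ≠ 2)
    (hCTf : ∀ (K : Type) [Field K] [NumberField K], casselsTate_levelInputs K)
    (hγf : ∀ (K : Type) [Field K] [NumberField K], prop37_2_reductionCongruence (W.conductorNorm ℤ) W K p)
    (hJW : ∀ (K : Type) [Field K] [NumberField K], IsImaginaryQuadratic K →
      NumberField.discr K ≠ -3 → NumberField.discr K ≠ -4 → SatisfiesHeegnerHypothesis (W.conductorNorm ℤ) K →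
      ∀ (Dt : ModularParametrizationData W (W.conductorNorm ℤ)) (β : ℤ) (ι : K →+* ℂ),
      ∃ n' : ℤ, IsCoprime (p : ℤ) n' ∧ ∀ (m : ℕ), Squarefree m →
        (∀ q ∈ m.primeFactors, Zhang2014.IsKolyvaginPrime (W.conductorNorm ℤ) W K p q) →
        ∀ (dm : KolyvaginHeegnerData Dt β ι m)
        (γ : ringClassField K ι m ≃ₐ[ℚ] ringClassField K ι m), γ ∈ ringClassGal ι m →
        ∀ v : HeightOneSpectrum (𝓞 K), ¬ (W.baseChange K).HasGoodReductionAt v →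
          n' • pointsMap (W.baseChange K) (v.adicCompletion K)
              (dm.toGeomPoints (pointGalHom W (ringClassField K ι m) γ dm.y)) ∈
            E0Receptacle (W.baseChange K) v ∧
          ∀ (ℓ : ℕ), ℓ ∈ m.primeFactors → ∀ (dm' : KolyvaginHeegnerData Dt β ι (m / ℓ))
            (hle : ringClassField K ι (m / ℓ) ≤ ringClassField K ι m),
            n' • pointsMap (W.baseChange K) (v.adicCompletion K)
                (dm.toGeomPoints (pointGalHom W (ringClassField K ι m) γ
                  (WeierstrassCurve.Affine.Point.map (W' := W)
                    ((RingClassField.inclusion ι hle).restrictScalars ℚ) dm'.y))) ∈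
              E0Receptacle (W.baseChange K) v) :
    ¬ W.HasCM →
    ∀ (K : Type) [Field K] [NumberField K], IsImaginaryQuadratic K →
    NumberField.discr K ≠ -3 → NumberField.discr K ≠ -4 →
    SatisfiesHeegnerHypothesis (W.conductorNorm ℤ) K →
    (∀ n : ℕ, W.HasSurjectiveModNGaloisRep (p ^ n : ℕ)) →
    ∀ (Dt : ModularParametrizationData W (W.conductorNorm ℤ)) (β : ℤ) (ι : K →+* ℂ)
      (d₁ : KolyvaginHeegnerData Dt β ι 1) (P : (W.baseChange K).toAffine.Point),
      d₁.toGeomPoints d₁.derivedPoint = toGeomPoints (W.baseChange K) P →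
      ¬ IsOfFinAddOrder P →
    ∀ (M₀ : ℕ),
      (∃ Q : (W.baseChange K).toAffine.Point, ((p ^ M₀ : ℕ) : ℤ) • Q = P) →
      (¬ ∃ Q : (W.baseChange K).toAffine.Point, ((p ^ (M₀ + 1) : ℕ) : ℤ) • Q = P) →
    ∀ (t : ℕ),
      (∀ (s : ℕ), s ≤ t → ∀ (n : ℕ) (d : KolyvaginHeegnerData Dt β ι n), Squarefree n →
        (∀ ℓ ∈ n.primeFactors, Zhang2014.IsKolyvaginPrime (W.conductorNorm ℤ) W K p ℓ ∧
          s ≤ Zhang2014.kolyvaginIndex W p ℓ) →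
        ∃ Q : (W.baseChange (ringClassField K ι n)).toAffine.Point,
          ((p ^ s : ℕ) : ℤ) • Q = d.derivedPoint) →
    padicValNat p (Nat.card (AddCommGroup.primaryComponent (W.baseChange K).sha p)) + 2 * t ≤ 2 * M₀ := by
  intro hE K _ _ hK hD3 hD4 hH htower Dt β ι d₁ P hP1 hnt M₀ hM₀div hM₀max t hglob
  have hp : p.Prime := Fact.out
  have hρ : W.HasSurjectiveModNGaloisRep p := by simpa using htower 1
  -- Gross Prop. 3.7 (2) at `(W, K, p)` as a local of the named type (explicit mode: no eager unfolding)
  have hγ : prop37_2_reductionCongruence (W.conductorNorm ℤ) W K p := @hγf K _ _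
  have hD34 : NumberField.discr K ≠ -3 ∧ NumberField.discr K ≠ -4 := ⟨hD3, hD4⟩
  have hrec := heegnerPointOfConductor_one_galoisConj_holds (W.conductorNorm ℤ) W K
  -- `P ↔ P(1)` on the fact's frame
  have hmapP : WeierstrassCurve.Affine.Point.map (W' := W)
      (algebraMap K (ringClassField K ι 1)).toRatAlgHom P = d₁.derivedPoint := by
    apply WeierstrassCurve.Affine.Point.map_injective (W' := W) d₁.emb.toRatAlgHom
    change d₁.toGeomPoints _ = d₁.toGeomPoints _
    rw [KolyvaginBottom.toGeomPoints_map_algebraMap d₁ P, hP1]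
  -- the Heegner display of `P` on THIS frame (Shimura reciprocity at conductor `1`)
  obtain ⟨H, hHβ⟩ := exists_heegnerDatum (W.conductorNorm ℤ) hK.discr_neg d₁.dvd_sq_sub
  have hPH : WeierstrassCurve.Affine.Point.map (W' := W) ι.toRatAlgHom P = heegnerPointComplex Dt H := by
    obtain ⟨e1, he1⟩ := hrec hK hH Dt β ι d₁ H hHβ
    have hι : ι.toRatAlgHom = (ringClassField K ι 1).subtype.toRatAlgHom.comp
        (algebraMap K (ringClassField K ι 1)).toRatAlgHom := by
      ext x
      rfl
    rw [hι, ← WeierstrassCurve.Affine.Point.map_map, hmapP, d₁.derivedPoint_one, map_sum,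
      heegnerPointComplex, ← Finset.sum_coe_sort H.reps, ← Finset.sum_coe_sort d₁.S]
    exact Fintype.sum_equiv e1 _ _ fun s ↦ he1 s
  have hHP : IsHeegnerPoint (W.conductorNorm ℤ) W K P := ⟨Dt, H, ι, hPH⟩
  have hc1 : ∀ d : KolyvaginHeegnerData Dt β ι 1,
      d.toGeomPoints d.derivedPoint = (W.baseChange K).toGeomPoints P :=
    fun d ↦ KolyvaginBottom.toGeomPoints_derivedPoint_one_eq hrec hK hH hPH d hHβ
  -- the class-form divisibility on the frame, from the fact's global divisibility at depth `min M t`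
  have hDivT : ∀ {M : ℕ} (_hM : 1 ≤ M) {n : ℕ} (_hn : Squarefree n)
      (_hKol : ∀ q ∈ n.primeFactors, IsKolyvaginPrime (W.conductorNorm ℤ) W K p q ∧
        FrobEqFrobInfty W K (p ^ M) q)
      (d : (m : ℕ) → m ∣ n → KolyvaginHeegnerData Dt β ι m),
      ((p : ℤ) ^ (M - t)) • (d n dvd_rfl).kolyvaginClass hp M = 0 := by
    intro M hM n hn hKol d
    have hZ : ∀ ℓ ∈ n.primeFactors, Zhang2014.IsKolyvaginPrime (W.conductorNorm ℤ) W K p ℓ ∧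
        min M t ≤ Zhang2014.kolyvaginIndex W p ℓ := by
      intro ℓ hℓ
      obtain ⟨⟨hℓP, hℓN, hℓD, hℓp, hprime, -⟩, hfrob⟩ := hKol ℓ hℓ
      have hidx : M ≤ Zhang2014.kolyvaginIndex W p ℓ :=
        McCallum1991.le_kolyvaginIndex_of_frobEqFrobInfty W K hp hM hℓP hℓp hℓN hfrob
      exact ⟨⟨hℓP, hℓN, hℓD, hℓp, hprime, lt_of_lt_of_le (by omega) hidx⟩, (min_le_left _ _).trans hidx⟩
    obtain ⟨Q, hQ⟩ := hglob (min M t) (min_le_right M t) n (d n dvd_rfl) hn hZ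
    set dn := d n dvd_rfl with hdn
    by_cases hadm : KolyvaginCocycle.IsAdmissible (Field.absoluteGaloisGroup K) dn.pointsSubgroup
          ((p ^ M : ℕ) : ℤ) ∧
        dn.toGeomPoints dn.derivedPoint ∈
          KolyvaginCocycle.invPoints (Field.absoluteGaloisGroup K) dn.pointsSubgroup ((p ^ M : ℕ) : ℤ)
    swap
    · rw [KolyvaginHeegnerData.kolyvaginClass, dif_neg hadm, zsmul_zero]
    obtain ⟨hA, hP⟩ := hadm
    rw [KolyvaginHeegnerData.kolyvaginClass_of_admissible _ hp M hA hP]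
    obtain ⟨Q0, hQ0⟩ := (W.baseChange K).zsmul_geomPoints_surjective_of_charZero
      (n := ((p ^ M : ℕ) : ℤ)) (by exact_mod_cast pow_ne_zero M hp.ne_zero) (dn.toGeomPoints dn.derivedPoint)
    simp only at hQ0
    have hkP : ((p : ℤ) ^ (M - t)) • dn.toGeomPoints dn.derivedPoint ∈
        KolyvaginCocycle.invPoints (Field.absoluteGaloisGroup K) dn.pointsSubgroup ((p ^ M : ℕ) : ℤ) :=
      AddSubgroup.zsmul_mem _ hP _
    have hkQ : ((p ^ M : ℕ) : ℤ) • (((p : ℤ) ^ (M - t)) • Q0) =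
        ((p : ℤ) ^ (M - t)) • dn.toGeomPoints dn.derivedPoint := by
      rw [smul_comm, hQ0]
    rw [kolyvaginClass_eq_cls hA hP hQ0, ← cls_zsmul hA _ hP hQ0 ((p : ℤ) ^ (M - t)) hkP hkQ]
    refine cls_eq_zero_of_mem hA _ hkP hkQ ⟨dn.toGeomPoints Q, ⟨Q, rfl⟩, ?_⟩
    have hexp : M - t + min M t = M := by omega
    have hsc : ((p : ℤ) ^ (M - t)) * ((p ^ min M t : ℕ) : ℤ) = ((p ^ M : ℕ) : ℤ) := by
      push_cast
      rw [← pow_add, hexp]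
    rw [← hQ, ← map_zsmul, ← map_zsmul, smul_smul, hsc]
  -- the generator `x₀` and the maximality, in the END's currency
  obtain ⟨x₀, hx₀'⟩ := hM₀div
  have hx₀ : p ^ M₀ • x₀ = P := by rw [← natCast_zsmul]; exact_mod_cast hx₀'
  have hmax : ∀ Q : (W.baseChange K).toAffine.Point, p ^ (M₀ + 1) • Q ≠ P := fun Q hQ ↦
    hM₀max ⟨Q, by rw [← natCast_zsmul] at hQ; exact_mod_cast hQ⟩
  rcases Nat.eq_zero_or_pos M₀ with h0 | hpos
  · -- `M₀ = 0`: `Ш(E/K)[p^∞] = 0` (x11b3's annihilator END at `m = 0`) and `t = 0` (McCallum Lemma 5.1)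
    subst h0
    have ht0 : t = 0 := by
      by_contra ht
      obtain ⟨Q₁, hQ₁⟩ := hglob t le_rfl 1 d₁ squarefree_one (by simp)
      have hP' : Three.Koly.PDiv d₁ p t := ⟨Q₁, hQ₁⟩
      obtain ⟨Q, hQ⟩ := (Three.Koly.pDiv_one_iff_exists_zsmul_eq hK d₁ P hmapP p t
        (fun R hR ↦ RingClassNoTorsion.eq_zero_of_zsmul_pow_eq_zero_ringClassField W hK ι one_ne_zero
          hp hp2 hρ t R hR)).mp hP'
      refine hM₀max ⟨((p ^ (t - 1) : ℕ) : ℤ) • Q, ?_⟩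
      rw [smul_smul, ← Nat.cast_mul, ← pow_add, show 0 + 1 + (t - 1) = t by omega, hQ]
    subst ht0
    -- site (4) re-threaded: x11b's annihilator leaf form with the `hGZ` binder from the per-curve JET supply (§2)
    have hkill := KolyvaginAnnihilator.pow_smul_sha_primary_eq_zero_at_of_leafInputs_of_poitouTate
      (N := W.conductorNorm ℤ) (W := W) (K := K) hp hp2 (poitouTate_sum_localTatePairing_eq_zero_holds K) (@fun _ ↦ rfl)
      hrec (KolyvaginLeaves.hCM_holds (W.conductorNorm ℤ) W K p)
      (@fun _ ↦ KolyvaginLeaves.h53_holds (N := W.conductorNorm ℤ) (W := W) (K := K) rfl p)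
      (hGZHlocBinder_of_hGZJetW W K hD3 hD4 hp (hJW K))
      (hγ.endBinder (@fun _ ↦ hE) hD34 hp hp2 (@fun _ ↦ hρ) (@fun _ ↦ rfl)) hE hK hD34 hH hHP hnt hρ (m := 0) hmax
    have hbot : ∀ c ∈ AddCommGroup.primaryComponent (W.baseChange K).sha p, c = 0 := by
      intro c hc
      obtain ⟨j, hj⟩ := (AddCommGroup.mem_primaryComponent).1 hc
      simpa using hkill c ⟨j, hj⟩
    have hcard : Nat.card (AddCommGroup.primaryComponent (W.baseChange K).sha p) = 1 := by
      rw [Nat.card_eq_one_iff_exists]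
      exact ⟨⟨0, zero_mem _⟩, fun c ↦ Subtype.ext (hbot c.1 c.2)⟩
    rw [hcard]
    simp
  -- `M₀ ≥ 1`: the END on the fact's frame, with the Weil pairing at level `p^{2M₀}` and the
  -- Cassels–Tate inputs from `casselsTate_levelInputs`
  haveI : NeZero (p ^ M₀) := ⟨pow_ne_zero _ hp.ne_zero⟩
  obtain ⟨c, hc1', hcc⟩ := exists_conj_of_isImaginaryQuadratic (K := K) hK
  have h2 : 2 ≤ p ^ M₀ * p ^ M₀ :=
    le_trans (le_trans hp.two_le (Nat.le_self_pow hpos.ne' p)) (Nat.le_mul_of_pos_right _ (NeZero.pos (p ^ M₀)))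
  have hq : ((p ^ M₀ * p ^ M₀ : ℕ) : K) ≠ 0 := Nat.cast_ne_zero.mpr (NeZero.ne (p ^ M₀ * p ^ M₀))
  obtain ⟨e, hμ, hadd₁, hadd₂, halt, hnd, hgal⟩ :=
    (W.baseChange K).exists_weilPairing_holds (p ^ M₀ * p ^ M₀) h2 hq
  obtain ⟨inv, hPT', hH3, hperf, hB, hPτ⟩ := hCTf K W p M₀ hp hp2 hpos c hc1' hcc e hμ hadd₁ hadd₂ hgal halt hnd
  -- site (3) re-threaded: x11b's order END on the frame, `hpoints` from the per-level choice with the `hGZ` binder from §2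
  exact (KolyvaginOrder.card_sha_primary_le_at_of_pointsMDiv_of_reciprocityFinset_of_localDuality W hK hHP hnt hp hp2 hρ hpos
    hc1' hcc hx₀ hmax t
    (hpoints_at_of_perLevelChoice_of_divT_frame (N := W.conductorNorm ℤ) rfl hK hD34 hH hHP hp hp2 hρ Dt β ι d₁.dvd_sq_sub hc1
      (KolyvaginLeaves.hCM_holds (W.conductorNorm ℤ) W K p) (KolyvaginLeaves.h53_holds (N := W.conductorNorm ℤ) (W := W) (K := K) rfl p)
      (hGZHlocBinder_of_hGZJetW W K hD3 hD4 hp (hJW K))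
      (hγ.endBinder (@fun _ ↦ hE) hD34 hp hp2 (@fun _ ↦ hρ) (@fun _ ↦ rfl)) t hDivT)
    (@fun _ hM _ hℓ hℓM ↦ KolyvaginReciprocity.kolyvaginReciprocityFinset_of_poitouTate (W.conductorNorm ℤ) W K
      (poitouTate_sum_localTatePairing_eq_zero_holds K) hE hK hD34 hH hHP hnt hp hp2 hρ hM hℓ hℓM)
    e hμ hadd₁ hadd₂ hgal halt hnd inv hPT' (fun v ↦ (hperf v).1.injective) hH3 hB hPτ).2.2.2


/-! ### §4 Sanity: the old global fact gives the per-curve supply (so §3 specialises back to the tree's theorem at `(W, p)`) -/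

/-- **The per-curve JET supply at `(W, p)` from the GLOBAL fact [GZ86 III (3.1)] ∕ Gross §6** (`p ≠ 2`, `ρ̄_{E,p}` onto; bsd-jet's
`JET.forall_hGZ_of_Gross1991`, the ring-class-field instance family by `JET.numberField_ringClassField`). Shows the per-curve binder `hJW` of §3
is WEAKER than the fact it replaces: the re-thread loses nothing. [cite: GrossLMS1991, §6 proof of Prop. 6.2 (1)] [cite: Cox2013, §9.A] -/
theorem hGZJetW_of_Gross1991 (hF1 : Gross1991_heegnerPoint_sub_ratTorsion_mem_E0)
    (W : WeierstrassCurve ℚ) [W.IsElliptic] [W.IsGloballyMinimal] [NeZero (W.conductorNorm ℤ)]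
    {p : ℕ} [Fact p.Prime] (hp2 : p ≠ 2) (hρ : W.HasSurjectiveModNGaloisRep p) :
    ∀ (K : Type) [Field K] [NumberField K], IsImaginaryQuadratic K →
      NumberField.discr K ≠ -3 → NumberField.discr K ≠ -4 → SatisfiesHeegnerHypothesis (W.conductorNorm ℤ) K →
      ∀ (Dt : ModularParametrizationData W (W.conductorNorm ℤ)) (β : ℤ) (ι : K →+* ℂ),
      ∃ n' : ℤ, IsCoprime (p : ℤ) n' ∧ ∀ (m : ℕ), Squarefree m →
        (∀ q ∈ m.primeFactors, Zhang2014.IsKolyvaginPrime (W.conductorNorm ℤ) W K p q) →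
        ∀ (dm : KolyvaginHeegnerData Dt β ι m)
        (γ : ringClassField K ι m ≃ₐ[ℚ] ringClassField K ι m), γ ∈ ringClassGal ι m →
        ∀ v : HeightOneSpectrum (𝓞 K), ¬ (W.baseChange K).HasGoodReductionAt v →
          n' • pointsMap (W.baseChange K) (v.adicCompletion K)
              (dm.toGeomPoints (pointGalHom W (ringClassField K ι m) γ dm.y)) ∈
            E0Receptacle (W.baseChange K) v ∧
          ∀ (ℓ : ℕ), ℓ ∈ m.primeFactors → ∀ (dm' : KolyvaginHeegnerData Dt β ι (m / ℓ))
            (hle : ringClassField K ι (m / ℓ) ≤ ringClassField K ι m),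
            n' • pointsMap (W.baseChange K) (v.adicCompletion K)
                (dm.toGeomPoints (pointGalHom W (ringClassField K ι m) γ
                  (WeierstrassCurve.Affine.Point.map (W' := W)
                    ((RingClassField.inclusion ι hle).restrictScalars ℚ) dm'.y))) ∈
              E0Receptacle (W.baseChange K) v := by
  intro K _ _ hK hD3 hD4 hH Dt β ι
  haveI : ∀ j : ℕ, NumberField (ringClassField K ι j) := fun j ↦ JET.numberField_ringClassField K hK ι j
  exact JET.forall_hGZ_of_Gross1991 hF1 W K hK hD3 hD4 hH p hp2 hρ Dt β ι

/-- **Corollary (compatibility): the tree's McCallum Cor. 5.6 upper at `(W, p)` is §3 on §4** — the named fact's instance at `(W, p)` from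
{`casselsTate_levelInputs`, `GrossLMS1991.prop37_2_frobeniusCongruence`, the global `E⁰` fact}, re-derived through the per-curve binder.
[cite: McCallumLMS1991, Cor. 5.6] [cite: GrossLMS1991, Prop. 3.7 (2), §6] -/
theorem mcCallumUpperAt_of_casselsTate_of_frobeniusCongruence_of_E0
    (W : WeierstrassCurve ℚ) [W.IsElliptic] [W.IsGloballyMinimal] [NeZero (W.conductorNorm ℤ)]
    (p : ℕ) [Fact p.Prime] (hp2 : p ≠ 2) (hρ : W.HasSurjectiveModNGaloisRep p)
    (hCTf : ∀ (K : Type) [Field K] [NumberField K], casselsTate_levelInputs K)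
    (h372 : GrossLMS1991.prop37_2_frobeniusCongruence)
    (hE0 : Gross1991_heegnerPoint_sub_ratTorsion_mem_E0) :
    ¬ W.HasCM →
    ∀ (K : Type) [Field K] [NumberField K], IsImaginaryQuadratic K →
    NumberField.discr K ≠ -3 → NumberField.discr K ≠ -4 →
    SatisfiesHeegnerHypothesis (W.conductorNorm ℤ) K →
    (∀ n : ℕ, W.HasSurjectiveModNGaloisRep (p ^ n : ℕ)) →
    ∀ (Dt : ModularParametrizationData W (W.conductorNorm ℤ)) (β : ℤ) (ι : K →+* ℂ)
      (d₁ : KolyvaginHeegnerData Dt β ι 1) (P : (W.baseChange K).toAffine.Point),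
      d₁.toGeomPoints d₁.derivedPoint = toGeomPoints (W.baseChange K) P →
      ¬ IsOfFinAddOrder P →
    ∀ (M₀ : ℕ),
      (∃ Q : (W.baseChange K).toAffine.Point, ((p ^ M₀ : ℕ) : ℤ) • Q = P) →
      (¬ ∃ Q : (W.baseChange K).toAffine.Point, ((p ^ (M₀ + 1) : ℕ) : ℤ) • Q = P) →
    ∀ (t : ℕ),
      (∀ (s : ℕ), s ≤ t → ∀ (n : ℕ) (d : KolyvaginHeegnerData Dt β ι n), Squarefree n →
        (∀ ℓ ∈ n.primeFactors, Zhang2014.IsKolyvaginPrime (W.conductorNorm ℤ) W K p ℓ ∧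
          s ≤ Zhang2014.kolyvaginIndex W p ℓ) →
        ∃ Q : (W.baseChange (ringClassField K ι n)).toAffine.Point,
          ((p ^ s : ℕ) : ℤ) • Q = d.derivedPoint) →
    padicValNat p (Nat.card (AddCommGroup.primaryComponent (W.baseChange K).sha p)) + 2 * t ≤ 2 * M₀ :=
  mcCallumUpperAt_of_casselsTate_of_prop37_of_hGZJetW W p hp2 hCTf
    (fun K _ _ ↦ GrossLMS1991.prop37_2_reductionCongruence_of_frobeniusCongruence h372 (W.conductorNorm ℤ) W K p)
    (hGZJetW_of_Gross1991 hE0 W hp2 hρ)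

end Summit.BirchSwinnertonDyer.BirchSwinnertonDyer.Cruxes.EulerHalfNotRamNoInertSetAtFive.ModularRethread

end
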